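import Summits.FinalStateConjecture.FinalStateConjecture.Theorems.PhaseMixingCaptureBulkKerrCaptureC2Centre
import Literature.Geometry.Lorentzian.CauchyDevelopmentPrecomp
import Literature.Geometry.Lorentzian.InitialDataLocality
import HarnessLib

/-!
# Crux `PhaseMixingCapture.BulkKerrCaptureC2` (stmt-FinalStateConjecture-14985): the crux holds on the
# compactly supported GAUGE ORBIT of the centre of every data ball

Support file, sequel of `PhaseMixingCaptureBulkKerrCaptureC2Centre.lean` (the conclusion of the crux at the
exact Kerr datum `Kerr.data M a M`).  The hypotheses of the crux's matrix `CaptureC2At` (`H^s_δ`-distance to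
`Kerr.data M a M` in the FIXED Kerr–Schild chart) are not invariant under diffeomorphisms of the slice,
but its conclusion is a statement about the maximal developments, which is: if `Φ` is a diffeomorphism of
`Kerr.slice a M` (a homeomorphism, smooth with injective differentials) which is the identity outside a
compact set, the pulled-back datum `Φ^* Kerr.data M a M` (`InitialDataSet.comap`) — again a solution of the
vacuum constraints (`isVacuumConstraintSolution_gauge`), and for `Φ` close to the identity a competitor
inside the ball — has the SAME developments as the Kerr datum, re-indexed along `Φ`
(`VacuumCauchyDevelopment.precomp`, `CauchyDevelopmentPrecomp.lean`).

* `hasCompleteFutureNullInfinityFrom_precomp` — far-origin (restricted-origin) sojourn completeness of `𝓘⁺`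
  passes to the re-indexed development `(M, g, τ, ι ∘ Φ, ν ∘ Φ)` when `Φ` fixes the complement of a compact
  set `K₀` (the reference set becomes `Φ⁻¹ B₀`, the exemption set `Φ⁻¹ B₁ ∪ K₀`; a ray from `q ∉ K₀` for
  `(ι ∘ Φ, ν ∘ Φ)` IS a ray from `Φ q = q` for `(ι, ν)`); the all-origin case is the tree's
  `hasCompleteFutureNullInfinity_precomp_iff`;
* `exists_goodDevelopment_gauge` — ONE good development of `Φ^* Kerr.data M a M`: the Kerr slab re-indexed
  along `Φ` (same spacetime, so it still converges to `g_{M,a}` in every `Cᵏ`, `Centre.convergesToKerr_slab`);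
* `conclusion_gauge`, `captureC2At_gauge` — hence EVERY maximal vacuum Cauchy development of
  `Φ^* Kerr.data M a M` is far-complete and has a region converging in `Cᵏ` to `g_{M,a}` (ascent along the
  embedding provided by maximality, `CaptureAscent`), and the matrix of the crux holds at these data with
  `(M', a') = (M, a)`: a refutation of the crux cannot use a pure-gauge perturbation of the centre
  (`not_gauge_of_not_conclusion`).

Nothing here closes the crux; no named fact is consumed.

References: Y. Choquet-Bruhat, R. Geroch, CMP 14 (1969), p. 330 and Thm. 3; H. Ringström, *The Cauchy problem
in General Relativity* (2009), Def. 16.2–16.5; R. Bartnik, J. Isenberg, *The constraint equations* (2004), §2;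
D. Christodoulou, CQG 16 (1999) A23, pp. A26–A27; M. Dafermos, I. Rodnianski, arXiv:0811.0354, §2.6.2.
-/

-- the doubled `FinalStateConjecture.FinalStateConjecture` path component trips dupNamespace
set_option linter.dupNamespace false

noncomputable section

open Set Filter Function Topology
open scoped Manifold ContDiff Topology
open Literature.Geometry.Lorentzian
open Summit.FinalStateConjecture.FinalStateConjecture.Theorems.NearExtremalKappaCapture.UnitTemperatureFrontFace.CentreFarComplete
  (farComplete_kerrSlab)
open Summit.FinalStateConjecture.FinalStateConjecture.Theorems.NearExtremalKappaCapture.AreaExcessRatchet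
  (farComplete_iff_hasCompleteFutureNullInfinityFar)
open Summit.FinalStateConjecture.FinalStateConjecture.Theorems.BulkKerrCaptureC2.CaptureAscent
  (hasCompleteFutureNullInfinityFar_of_embedsInto convergesToKerr_of_embedsInto)

namespace Summit.FinalStateConjecture.FinalStateConjecture.Theorems.BulkKerrCaptureC2.Centre

open NearExtremalKappaCapture.UnitTemperatureFrontFace.KerrSlab

/-! ## §1 Far-origin completeness of `𝓘⁺` passes to the re-indexed development -/

section Precomp

variable {X : Type} [TopologicalSpace X] [ChartedSpace E3 X] [IsManifold (𝓡 3) ∞ X] [ConnectedSpace X]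
  {D : InitialDataSet (𝓡 3) X}

/-- **Restricted-origin sojourn completeness of `𝓘⁺` is inherited by the development re-indexed along a
diffeomorphism of the data manifold fixing the complement of a compact set.**  If `𝒟 = (M, g, τ, ι, ν)` has
complete `𝓘⁺` as seen from the origins `A ⊆ X` and `Φ : X ≃ₜ X` (smooth, injective differentials) satisfies
`Φ y = y` off the compact `K₀`, then `precomp 𝒟 Φ = (M, g, τ, ι ∘ Φ, ν ∘ Φ)` has complete `𝓘⁺` as seen from
`A`: take the reference set `Φ⁻¹ B₀` (so that `(ι ∘ Φ)(Φ⁻¹ B₀) = ι B₀`) and the exemption set `Φ⁻¹ B₁ ∪ K₀`;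
a normalised null ray from `q ∈ A ∖ (Φ⁻¹ B₁ ∪ K₀)` for `(ι ∘ Φ, ν ∘ Φ)` is one from `Φ q = q ∈ A ∖ B₁` for
`(ι, ν)`.  Christodoulou, CQG 16 (1999), pp. A26–A27 (the notion); Choquet-Bruhat–Geroch 1969, p. 330
(diffeomorphism covariance). [cite: Christodoulou1999, pp. A26–A27] -/
theorem hasCompleteFutureNullInfinityFrom_precomp (𝒟 : VacuumCauchyDevelopment D) (Φ : X ≃ₜ X)
    (hΦ : ContMDiff (𝓡 3) (𝓡 3) (∞ + 1) Φ) (hΦ' : ∀ u, Injective (mfderiv (𝓡 3) (𝓡 3) Φ u))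
    {A K₀ : Set X} (hK₀ : IsCompact K₀) (hfix : ∀ y, y ∉ K₀ → Φ y = y)
    (h : 𝒟.HasCompleteFutureNullInfinityFrom A) :
    (𝒟.precomp Φ hΦ hΦ').HasCompleteFutureNullInfinityFrom A := by
  intro inst
  haveI : 𝒟.metric.HasLeviCivita := inst
  obtain ⟨B₀, hB₀, H⟩ := @h inst
  refine ⟨Φ ⁻¹' B₀, Φ.isCompact_preimage.2 hB₀, fun s hs ↦ ?_⟩
  obtain ⟨B₁, hB₁, H₁⟩ := H s hs
  refine ⟨Φ ⁻¹' B₁ ∪ K₀, (Φ.isCompact_preimage.2 hB₁).union hK₀, fun q hqA hqB γ dom hγ ↦ ?_⟩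
  have hqK : q ∉ K₀ := fun h' ↦ hqB (Or.inr h')
  have hq₁ : Φ q ∉ B₁ := fun h' ↦ hqB (Or.inl h')
  have hΦq : Φ q = q := hfix q hqK
  have hqA' : Φ q ∈ A := by rw [hΦq]; exact hqA
  have hγ' : 𝒟.metric.IsNormalisedNullRayFrom 𝒟.timeOrientation 𝒟.embed 𝒟.normal (Φ q) γ dom := hγ
  have himg : (𝒟.embed ∘ Φ) '' (Φ ⁻¹' B₀) = 𝒟.embed '' B₀ := by
    rw [Set.image_comp, Φ.image_preimage]
  change ¬ BddAbove dom ∨ ENNReal.ofReal s ≤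
    sojournTime γ dom (𝒟.metric.causalFuture 𝒟.timeOrientation ((𝒟.embed ∘ Φ) '' (Φ ⁻¹' B₀)))
  rw [himg]
  exact H₁ (Φ q) hqA' hq₁ γ dom hγ'

/-- **Far-origin completeness on the Kerr–Schild slices is inherited by the re-indexed development**
(`hasCompleteFutureNullInfinityFrom_precomp` with the far origins `{afRadius + 1 ≤ ‖q‖}` of
`DataEmbedding.HasCompleteFutureNullInfinityFar`). Dafermos–Rodnianski arXiv:0811.0354, §2.6.2.
[cite: arXiv08110354, §2.6.2] -/
theorem hasCompleteFutureNullInfinityFar_precomp [Kerr.SliceFacts] {a r₀ : ℝ}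
    {D : InitialDataSet 𝓘(ℝ, E3) (Kerr.slice a r₀)} (𝒟 : VacuumCauchyDevelopment D)
    (Φ : Kerr.slice a r₀ ≃ₜ Kerr.slice a r₀)
    (hΦ : ContMDiff (𝓡 3) (𝓡 3) (∞ + 1) Φ) (hΦ' : ∀ u, Injective (mfderiv (𝓡 3) (𝓡 3) Φ u))
    {K₀ : Set (Kerr.slice a r₀)} (hK₀ : IsCompact K₀) (hfix : ∀ y, y ∉ K₀ → Φ y = y)
    (h : 𝒟.HasCompleteFutureNullInfinityFar) :
    (𝒟.precomp Φ hΦ hΦ').HasCompleteFutureNullInfinityFar :=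
  hasCompleteFutureNullInfinityFrom_precomp 𝒟 Φ hΦ hΦ' hK₀ hfix h

end Precomp

/-! ## §2 The gauge orbit of the centre -/

section Gauge

variable {M a : ℝ} [Kerr.Facts] [Kerr.SliceFacts]

/-- **The pulled-back Kerr datum solves the vacuum constraints**: `Φ^* Kerr.data M a M` is a vacuum
constraint solution for every smooth `Φ` with injective differentials (diffeomorphism equivariance of the
constraint map, `InitialDataSet.isVacuumConstraintSolution_comap`; the constraints of the Kerr data are the
tree theorem `Kerr.data_isVacuumConstraintSolution_holds`, and the mean curvature of the smooth Kerr data is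
differentiable). Bartnik–Isenberg 2004, §2. [cite: BartnikIsenberg2004, §2] -/
theorem isVacuumConstraintSolution_gauge (hM : 0 ≤ M) (Φ : Kerr.slice a M → Kerr.slice a M)
    (hΦ : ContMDiff (𝓡 3) (𝓡 3) (∞ + 1) Φ) (hΦ' : ∀ u, Injective (mfderiv (𝓡 3) (𝓡 3) Φ u))
    [((Kerr.data M a M hM).comap Φ hΦ hΦ').metric.HasLeviCivita] :
    ((Kerr.data M a M hM).comap Φ hΦ hΦ').IsVacuumConstraintSolution := by
  haveI := (Kerr.data M a M hM).metric.hasLeviCivita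
  exact (Kerr.data M a M hM).isVacuumConstraintSolution_comap' hΦ hΦ'
    (Kerr.data_isVacuumConstraintSolution_holds M a M hM)

/-- **One good development of a pure-gauge perturbation of the Kerr datum.**  For `0 < M`, `|a| < M`, every
`k`, and every diffeomorphism `Φ` of the slice which is the identity off a compact set, the datum
`Φ^* Kerr.data M a M` has a vacuum Cauchy development which is far-complete and has a region converging in
`Cᵏ` to `g_{M,a}`: the Kerr slab re-indexed along `Φ` (`VacuumCauchyDevelopment.precomp`; same spacetime,
`Centre.convergesToKerr_slab`; far-complete by `hasCompleteFutureNullInfinityFar_precomp` and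
`farComplete_kerrSlab`). Choquet-Bruhat–Geroch 1969, p. 330. [cite: ChoquetBruhatGeroch1969CMP, p. 330] -/
theorem exists_goodDevelopment_gauge (hM : 0 < M) (ha : |a| < M) (k : ℕ)
    (Φ : Kerr.slice a M ≃ₜ Kerr.slice a M)
    (hΦ : ContMDiff (𝓡 3) (𝓡 3) (∞ + 1) Φ) (hΦ' : ∀ u, Injective (mfderiv (𝓡 3) (𝓡 3) Φ u))
    {K₀ : Set (Kerr.slice a M)} (hK₀ : IsCompact K₀) (hfix : ∀ y, y ∉ K₀ → Φ y = y) :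
    ∃ (𝒟₀ : VacuumCauchyDevelopment ((Kerr.data M a M hM.le).comap Φ hΦ hΦ')) (𝒟oc : Set 𝒟₀.carrier),
      𝒟₀.HasCompleteFutureNullInfinityFar ∧ 𝒟₀.toSpacetime.ConvergesToKerr 𝒟oc M a k := by
  refine ⟨(development hM ha).precomp Φ hΦ hΦ', ?_⟩
  have hfar : ((development hM ha).precomp Φ hΦ hΦ').HasCompleteFutureNullInfinityFar :=
    hasCompleteFutureNullInfinityFar_precomp _ Φ hΦ hΦ' hK₀ hfix
      ((farComplete_iff_hasCompleteFutureNullInfinityFar _).1 (farComplete_kerrSlab hM ha))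
  -- the re-indexed slab has the same spacetime (`precomp_toSpacetime`, used as a rewrite so that no
  -- definitional unfolding of the slab is asked of the kernel)
  have hconv : ∃ 𝒟oc : Set ((development hM ha).precomp Φ hΦ hΦ').toSpacetime.carrier,
      ((development hM ha).precomp Φ hΦ hΦ').toSpacetime.ConvergesToKerr 𝒟oc M a k := by
    rw [VacuumCauchyDevelopment.precomp_toSpacetime]
    exact convergesToKerr_slab hM ha k
  obtain ⟨𝒟oc, h𝒟oc⟩ := hconv
  exact ⟨𝒟oc, hfar, h𝒟oc⟩

/-- **The conclusion of the crux on the compactly supported gauge orbit of the centre, parameters pinned,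
every order.**  For `0 < M`, `|a| < M`, every `k`, every diffeomorphism `Φ` of the slice equal to the identity
off a compact set, and every MAXIMAL vacuum Cauchy development `𝒟` of `Φ^* Kerr.data M a M`: `𝒟` is
far-complete and some region of `𝒟` converges in `Cᵏ` to `g_{M,a}` (maximality embeds the good development of
`exists_goodDevelopment_gauge`, and both properties ascend, `CaptureAscent`). Choquet-Bruhat–Geroch, CMP 14
(1969), Thm. 3; Ringström 2009, Def. 16.5. [cite: Ringstrom2009, Def. 16.5] -/
theorem conclusion_gauge (hM : 0 < M) (ha : |a| < M) (k : ℕ)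
    (Φ : Kerr.slice a M ≃ₜ Kerr.slice a M)
    (hΦ : ContMDiff (𝓡 3) (𝓡 3) (∞ + 1) Φ) (hΦ' : ∀ u, Injective (mfderiv (𝓡 3) (𝓡 3) Φ u))
    {K₀ : Set (Kerr.slice a M)} (hK₀ : IsCompact K₀) (hfix : ∀ y, y ∉ K₀ → Φ y = y)
    (𝒟 : VacuumCauchyDevelopment ((Kerr.data M a M hM.le).comap Φ hΦ hΦ')) (hmax : 𝒟.IsMaximal) :
    𝒟.HasCompleteFutureNullInfinityFar ∧
      ∃ 𝒟oc : Set 𝒟.carrier, 𝒟.toSpacetime.ConvergesToKerr 𝒟oc M a k := by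
  obtain ⟨𝒟₀, 𝒟oc₀, hfar, hconv⟩ := exists_goodDevelopment_gauge hM ha k Φ hΦ hΦ' hK₀ hfix
  have hemb : 𝒟₀.toCauchyDevelopment.EmbedsInto 𝒟.toCauchyDevelopment := hmax 𝒟₀
  exact ⟨hasCompleteFutureNullInfinityFar_of_embedsInto hemb hfar, convergesToKerr_of_embedsInto hemb hconv⟩

/-- **The matrix of the crux on the gauge orbit of its centre.**  For every tolerance `η ≥ 0`, `0 < M`,
`|a| < M`, every compactly supported diffeomorphism `Φ` of the slice and every MGHD `𝒟` of
`Φ^* Kerr.data M a M`, the conclusion of `CaptureC2At … η a` holds at `𝒟` with `(M', a') = (M, a)`.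
[cite: Ringstrom2009, Def. 16.5] -/
theorem captureC2At_gauge (hM : 0 < M) (ha : |a| < M) {η : ℝ} (hη : 0 ≤ η)
    (Φ : Kerr.slice a M ≃ₜ Kerr.slice a M)
    (hΦ : ContMDiff (𝓡 3) (𝓡 3) (∞ + 1) Φ) (hΦ' : ∀ u, Injective (mfderiv (𝓡 3) (𝓡 3) Φ u))
    {K₀ : Set (Kerr.slice a M)} (hK₀ : IsCompact K₀) (hfix : ∀ y, y ∉ K₀ → Φ y = y)
    (𝒟 : VacuumCauchyDevelopment ((Kerr.data M a M hM.le).comap Φ hΦ hΦ')) (hmax : 𝒟.IsMaximal) :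
    ∃ (M' a' : ℝ) (𝒟oc : Set 𝒟.carrier), Kerr.IsSubextremal M' a' ∧
      𝒟.HasCompleteFutureNullInfinityFar ∧
      𝒟.toSpacetime.ConvergesToKerr 𝒟oc M' a' 2 ∧ |M' - M| + |a' - a| ≤ η := by
  obtain ⟨hfar, 𝒟oc, hconv⟩ := conclusion_gauge hM ha 2 Φ hΦ hΦ' hK₀ hfix 𝒟 hmax
  exact ⟨M, a, 𝒟oc, ha, hfar, hconv, by simpa using hη⟩

/-- **A refutation of the crux cannot use a pure-gauge perturbation of the centre.**  If a datum `D` on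
`Kerr.slice a M` (`0 < M`, `|a| < M`) has a maximal vacuum Cauchy development violating the conclusion of
`CaptureC2At … η a` (`η ≥ 0`), then `D` is not of the form `Φ^* Kerr.data M a M` for any compactly supported
diffeomorphism `Φ` of the slice. [cite: Ringstrom2009, Def. 16.5] -/
theorem not_gauge_of_not_conclusion (hM : 0 < M) (ha : |a| < M) {η : ℝ} (hη : 0 ≤ η)
    {D : InitialDataSet 𝓘(ℝ, E3) (Kerr.slice a M)} (𝒟 : VacuumCauchyDevelopment D) (hmax : 𝒟.IsMaximal)
    (hbad : ¬ ∃ (M' a' : ℝ) (𝒟oc : Set 𝒟.carrier), Kerr.IsSubextremal M' a' ∧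
      𝒟.HasCompleteFutureNullInfinityFar ∧
      𝒟.toSpacetime.ConvergesToKerr 𝒟oc M' a' 2 ∧ |M' - M| + |a' - a| ≤ η)
    (Φ : Kerr.slice a M ≃ₜ Kerr.slice a M)
    (hΦ : ContMDiff (𝓡 3) (𝓡 3) (∞ + 1) Φ) (hΦ' : ∀ u, Injective (mfderiv (𝓡 3) (𝓡 3) Φ u))
    {K₀ : Set (Kerr.slice a M)} (hK₀ : IsCompact K₀) (hfix : ∀ y, y ∉ K₀ → Φ y = y) :
    D ≠ (Kerr.data M a M hM.le).comap Φ hΦ hΦ' := by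
  rintro rfl
  exact hbad (captureC2At_gauge hM ha hη Φ hΦ hΦ' hK₀ hfix 𝒟 hmax)

end Gauge

/-- **Registered sub-goal `stub_captureC2At_gauge`** (crux item stmt-FinalStateConjecture-14985): the matrix
`CaptureC2At` of the crux on the compactly supported gauge orbit of its centre datum — for every compactly
supported diffeomorphism `Φ` of the slice, every MGHD of `Φ^* Kerr.data M a M` is far-complete and has a
region converging in `C²` to a sub-extremal `g_{M',a'}` with `|M' − M| + |a' − a| ≤ η`, for every `η ≥ 0`
(closed form of `captureC2At_gauge`, witness `(M, a)`). [cite: Ringstrom2009, Def. 16.5] -/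
theorem stub_captureC2At_gauge : ∀ [Kerr.Facts] [Kerr.SliceFacts] (M : ℝ) (hM : 0 < M) (a : ℝ), |a| < M → ∀ η : ℝ, 0 ≤ η → ∀ (Φ : Kerr.slice a M ≃ₜ Kerr.slice a M) (hΦ : ContMDiff (𝓡 3) (𝓡 3) (∞ + 1) Φ) (hΦ' : ∀ u, Function.Injective (mfderiv (𝓡 3) (𝓡 3) Φ u)) (K₀ : Set (Kerr.slice a M)), IsCompact K₀ → (∀ y, y ∉ K₀ → Φ y = y) → ∀ 𝒟 : VacuumCauchyDevelopment ((Kerr.data M a M hM.le).comap Φ hΦ hΦ'), 𝒟.IsMaximal → ∃ (M' a' : ℝ) (𝒟oc : Set 𝒟.carrier), Kerr.IsSubextremal M' a' ∧ 𝒟.HasCompleteFutureNullInfinityFar ∧ 𝒟.toSpacetime.ConvergesToKerr 𝒟oc M' a' 2 ∧ |M' - M| + |a' - a| ≤ η :=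
  fun _ hM _ ha _ hη Φ hΦ hΦ' _ hK₀ hfix 𝒟 hmax ↦ captureC2At_gauge hM ha hη Φ hΦ hΦ' hK₀ hfix 𝒟 hmax

end Summit.FinalStateConjecture.FinalStateConjecture.Theorems.BulkKerrCaptureC2.Centre

end
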